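import Mathlib
import Literature.Computability.Complexity.CliqueTestGraphs
import Summits.PneNP.PneNP.Theorems.ConvexRankGatesConvexGateBlindThresholds
import Summits.PneNP.PneNP.Theorems.ConvexRankGatesConvexGateBlindMatchingCount
import Summits.PneNP.PneNP.Theorems.ConvexRankGatesConvexGateBlindSdpFewDims

/-!
# PneNP / ConvexRankGates — `ConvexGateBlind`: CONV gates need a PSD block of dimension ≳ m^{3/8}

Helpers (`--supports stmt-PneNP-10680`): an UNCONDITIONAL corner of the crux `ConvexGateBlind` with
GENUINE semidefinite variables. Combining `not_computes_cliqueFn_of_convFew` (`…SdpFewDims.lean`) with the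
matching count `card_colorings_sum_lt_le_half` (`…MatchingCount.lean`):
* `sdpFewDims_numerics`, `eventually_sdpFewDims_condition`, `eventually_sdpFewDims_budget` — exponent
  bookkeeping for `k = ⌈m^{1/4}⌉₊` and the block budget `64 (c + k + 2) (q² + 1) ≤ m`;
* `convexGateBlind_sdpFewDims_corner` — in the shape of the crux: for `δ = 1/4`, every `c` and all large
  `m`, no one-gate circuit over `{∧₂, ∨₂} ∪ CONV_{m^c}` (the route's gates verbatim: `p + q ≤ m^c`,
  `B ≥ 0`, SDP feasibility) whose PSD block has `64 (c + ⌈m^δ⌉₊ + 2)(q² + 1) ≤ m` computes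
  `CLIQUE(m, ⌈m^δ⌉₊)`. So a single monotone SDP-feasibility separator of `⌈m^{1/4}⌉`-cliques from
  `⌈m^{1/4}⌉`-clique-free graphs with `m^c` constraints needs a PSD block of dimension
  `q ≳ m^{3/8}/(8√(c+2))` (the Lovász theta gate has `q = m`).
Where the method stops: the number of vertex thresholds is `m^{O(k q²)}`, so the counting is void once
`k q² ≳ m`; the full crux (`q ≤ m^c`) is beyond it (its LP half is Hrubeš's Open Problem 3).
[folklore assembly; the counting is this route's]
-/

namespace Summit.PneNP.PneNP.Theorems

open Matrix Finset Filter Topology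

section sdpFewDimsCorner

open Literature.Computability.Complexity

/-! ### Exponent bookkeeping and the small-block corner in the shape of the crux -/

/-- Pure arithmetic for `k = ⌈m^{1/4}⌉₊` and the block budget `64 (c + k + 2) D ≤ m` (`D = t + 1`).
[folklore] -/
theorem sdpFewDims_numerics {m k c D : ℕ} (hk : 3 ≤ k) (h8 : m ≤ (k - 1) ^ 8) (hk2 : k ^ 2 ≤ m)
    (hD1 : 1 ≤ D) (hD : 64 * (c + k + 2) * D ≤ m)
    (hH : m / 8 + 8 + 9 * k ^ 2 + 8 * k + (m + k) / 2 + 1 ≤ m) (hm : 2 ≤ m) :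
    (m ^ c + 1) ^ D * m ^ k * (D + m ^ k + 2) ^ D *
      (k ^ 2 * m ^ (k ^ 2) * (k - 1) ^ ((m + k) / 2 + k ^ 2)) < (k - 1) ^ m := by
  set X := (c + k + 2) * D with hXdef
  have hX : 64 * X ≤ m := by rw [hXdef, ← mul_assoc]; exact hD
  have hk1 : 1 ≤ k := by omega
  have h1 : m ^ c + 1 ≤ m ^ (c + 1) := by
    rw [pow_succ]
    have : m ^ c * 2 ≤ m ^ c * m := Nat.mul_le_mul_left _ hm
    have hpos : 1 ≤ m ^ c := Nat.one_le_pow _ _ (by omega)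
    omega
  have hDm : D + 3 ≤ m := by
    have : 64 * D ≤ 64 * (c + k + 2) * D := by
      have : 1 ≤ c + k + 2 := by omega
      nlinarith
    omega
  have h2 : D + m ^ k + 2 ≤ m ^ (k + 1) := by
    have hmk : m ≤ m ^ k := by
      calc m = m ^ 1 := (pow_one m).symm
        _ ≤ m ^ k := Nat.pow_le_pow_right (by omega) hk1
    have : m ^ (k + 1) = m ^ k * m := pow_succ m k
    rw [this]
    have h2m : m ^ k * 2 ≤ m ^ k * m := Nat.mul_le_mul_left _ hm
    omega
  have h3 : (m ^ c + 1) ^ D * m ^ k * (D + m ^ k + 2) ^ D ≤ m ^ (X + k) := by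
    calc (m ^ c + 1) ^ D * m ^ k * (D + m ^ k + 2) ^ D
        ≤ (m ^ (c + 1)) ^ D * m ^ k * (m ^ (k + 1)) ^ D :=
          Nat.mul_le_mul (Nat.mul_le_mul_right _ (Nat.pow_le_pow_left h1 _)) (Nat.pow_le_pow_left h2 _)
      _ = m ^ (X + k) := by rw [hXdef, ← pow_mul, ← pow_mul, ← pow_add, ← pow_add]; ring_nf
  have h4 : k ^ 2 * m ^ (k ^ 2) ≤ m ^ (1 + k ^ 2) := by
    rw [pow_add, pow_one]
    exact Nat.mul_le_mul_right _ hk2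
  have h5 : m ^ (X + k) * m ^ (1 + k ^ 2) ≤ (k - 1) ^ (8 * (X + k + 1 + k ^ 2)) := by
    rw [← pow_add, pow_mul]
    have : X + k + (1 + k ^ 2) = X + k + 1 + k ^ 2 := by ring
    rw [this]
    exact Nat.pow_le_pow_left h8 _
  have hq8 : 8 * X ≤ m / 8 := by
    rw [Nat.le_div_iff_mul_le (by norm_num)]
    omega
  have hlt : 8 * (X + k + 1 + k ^ 2) + ((m + k) / 2 + k ^ 2) < m := by omega
  calc (m ^ c + 1) ^ D * m ^ k * (D + m ^ k + 2) ^ D *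
        (k ^ 2 * m ^ (k ^ 2) * (k - 1) ^ ((m + k) / 2 + k ^ 2))
      = ((m ^ c + 1) ^ D * m ^ k * (D + m ^ k + 2) ^ D) * (k ^ 2 * m ^ (k ^ 2)) *
          (k - 1) ^ ((m + k) / 2 + k ^ 2) := by ring
    _ ≤ m ^ (X + k) * m ^ (1 + k ^ 2) * (k - 1) ^ ((m + k) / 2 + k ^ 2) :=
        Nat.mul_le_mul_right _ (Nat.mul_le_mul h3 h4)
    _ ≤ (k - 1) ^ (8 * (X + k + 1 + k ^ 2)) * (k - 1) ^ ((m + k) / 2 + k ^ 2) :=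
        Nat.mul_le_mul_right _ h5
    _ = (k - 1) ^ (8 * (X + k + 1 + k ^ 2) + ((m + k) / 2 + k ^ 2)) := by rw [← pow_add]
    _ < (k - 1) ^ m := Nat.pow_lt_pow_right (by omega) hlt

/-- The side condition `m/8 + 8 + 9k² + 8k + (m+k)/2 + 1 ≤ m` holds for `k = ⌈m^{1/4}⌉₊` and all large
`m` (namely `m ≥ 16⁴`). [folklore] -/
theorem eventually_sdpFewDims_condition : ∀ᶠ m : ℕ in atTop,
    m / 8 + 8 + 9 * ⌈(m : ℝ) ^ (1 / 4 : ℝ)⌉₊ ^ 2 + 8 * ⌈(m : ℝ) ^ (1 / 4 : ℝ)⌉₊ +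
      (m + ⌈(m : ℝ) ^ (1 / 4 : ℝ)⌉₊) / 2 + 1 ≤ m := by
  filter_upwards [eventually_ge_atTop (16 ^ 4)] with m hm
  set x : ℝ := (m : ℝ) ^ (1 / 4 : ℝ) with hx
  set k : ℕ := ⌈x⌉₊ with hk
  have hx0 : 0 ≤ x := Real.rpow_nonneg (Nat.cast_nonneg m) _
  have hx4 : x ^ 4 = m := by
    rw [hx, ← Real.rpow_natCast, ← Real.rpow_mul (Nat.cast_nonneg m)]
    norm_num
  have hA : (16 : ℝ) ≤ x := by
    by_contra hcon
    push Not at hcon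
    have h1 : x ^ 4 < (16 : ℝ) ^ 4 := by gcongr
    have h2 : ((16 ^ 4 : ℕ) : ℝ) ≤ (m : ℝ) := by exact_mod_cast hm
    push_cast at h2
    linarith
  have hxk : x ≤ k := Nat.le_ceil x
  have hkx : (k : ℝ) < x + 1 := Nat.ceil_lt_add_one hx0
  have hk2x : (k : ℝ) ≤ 2 * x := by linarith
  have hk0 : (0 : ℝ) ≤ k := Nat.cast_nonneg k
  have hdiv8 : ((m / 8 : ℕ) : ℝ) ≤ (m : ℝ) / 8 := Nat.cast_div_le
  have hdiv2 : (((m + k) / 2 : ℕ) : ℝ) ≤ ((m + k : ℕ) : ℝ) / 2 := Nat.cast_div_le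
  have hmain : (m : ℝ) / 8 + 8 + 9 * (k : ℝ) ^ 2 + 8 * k + ((m : ℝ) + k) / 2 + 1 ≤ m := by
    have h1 : 9 * (k : ℝ) ^ 2 ≤ 36 * x ^ 2 := by nlinarith
    have hx2 : 256 ≤ x ^ 2 := by nlinarith
    have h2a : 36 * x ^ 2 + 17 * x + 10 ≤ 38 * x ^ 2 := by nlinarith
    have h2b : 38 * x ^ 2 ≤ 3 * x ^ 4 / 8 := by
      have h' : x ^ 4 = x ^ 2 * x ^ 2 := by ring
      rw [h']
      nlinarith
    rw [← hx4]
    nlinarith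
  have hcast : (((m / 8 + 8 + 9 * k ^ 2 + 8 * k + (m + k) / 2 + 1 : ℕ)) : ℝ) ≤ m := by
    push_cast
    push_cast at hdiv2
    linarith
  exact_mod_cast hcast

/-- The block budget is non-vacuous eventually: `64 (c + ⌈m^{1/4}⌉₊ + 2) ≤ m` for all large `m`
(namely `m ≥ (64 (c+4))⁴`). [folklore] -/
theorem eventually_sdpFewDims_budget (c : ℕ) : ∀ᶠ m : ℕ in atTop,
    64 * (c + ⌈(m : ℝ) ^ (1 / 4 : ℝ)⌉₊ + 2) ≤ m := by
  filter_upwards [eventually_ge_atTop ((64 * (c + 4)) ^ 4)] with m hm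
  set x : ℝ := (m : ℝ) ^ (1 / 4 : ℝ) with hx
  set k : ℕ := ⌈x⌉₊ with hk
  have hx0 : 0 ≤ x := Real.rpow_nonneg (Nat.cast_nonneg m) _
  have hx4 : x ^ 4 = m := by
    rw [hx, ← Real.rpow_natCast, ← Real.rpow_mul (Nat.cast_nonneg m)]
    norm_num
  have hA : (64 * (c + 4) : ℝ) ≤ x := by
    by_contra hcon
    push Not at hcon
    have h1 : x ^ 4 < (64 * (c + 4) : ℝ) ^ 4 := by gcongr
    have h2 : (((64 * (c + 4)) ^ 4 : ℕ) : ℝ) ≤ (m : ℝ) := by exact_mod_cast hm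
    push_cast at h2
    linarith
  have hc0 : (0 : ℝ) ≤ c := Nat.cast_nonneg c
  have hx1 : (1 : ℝ) ≤ x := by nlinarith
  have hkx : (k : ℝ) < x + 1 := Nat.ceil_lt_add_one hx0
  have hk2x : (k : ℝ) ≤ 2 * x := by linarith
  have h1 : (64 * (c + k + 2) : ℝ) ≤ 64 * (c + 4) * x := by nlinarith
  have h2 : 64 * (c + 4) * x ≤ x ^ 4 := by
    have h3 : 64 * (c + 4) * x ≤ x * x := by nlinarith
    have h4 : x * x ≤ x ^ 4 := by nlinarith [pow_pos (by linarith : (0:ℝ) < x) 2]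
    linarith
  have : ((64 * (c + k + 2) : ℕ) : ℝ) ≤ m := by
    push_cast
    rw [← hx4]
    exact h1.trans h2
  exact_mod_cast this

open scoped Classical in
/-- **`ConvexGateBlind`, small PSD block, one gate** (unconditional). There is `δ ∈ (0, 1/2)` (namely
`δ = 1/4`) such that for every `c`, for all large `m`, no circuit with at most one gate over
`{∧₂, ∨₂} ∪ CONV` — the route's SDP-feasibility gates `v ↦ [∃ Y ⪰ 0 (q × q), tr(Aᵢ Y) ≤ bᵢ + ∑ⱼ Bᵢⱼ [vⱼ]]`,
`B ≥ 0`, `p + q ≤ m^c`, whose PSD block is SMALL: `64 (c + ⌈m^δ⌉₊ + 2) (q² + 1) ≤ m`, i.e.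
`q ≲ m^{3/8} / (8 √(c+2))` — computes `CLIQUE(m, ⌈m^δ⌉₊)`, written inline as in the route file. This is
a corner of the crux with GENUINE semidefinite variables: extreme normalised dual certificates have
support `≤ q² + 1` (no spectral theory: perturb along `∑ dᵢ Aᵢ + d_λ I = 0`), and per support set a
cell/vertex argument leaves `m^{O(k q²)}` valid thresholds, each rejecting a `(k-1)^{-m/2+O(k²)}` fraction
of the colourings. The crux allows `q ≤ m^c` (theta uses `q = m`); its LP half alone is Hrubeš's open
problem. [folklore assembly; the count is this route's] -/
theorem convexGateBlind_sdpFewDims_corner :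
    ∃ δ : ℝ, 0 < δ ∧ δ < 1 / 2 ∧ ∀ c : ℕ, ∀ᶠ m : ℕ in atTop,
      ∀ C : Circuit ((⊤ : SimpleGraph (Fin m)).edgeSet),
        C.IsOver ({GateFn.and 2, GateFn.or 2} ∪ {g : GateFn | ∃ (p q : ℕ), p + q ≤ m ^ c ∧
          64 * (c + ⌈(m : ℝ) ^ δ⌉₊ + 2) * (q * q + 1) ≤ m ∧
          ∃ (A : Fin p → Matrix (Fin q) (Fin q) ℝ) (b : Fin p → ℝ) (B : Fin p → Fin g.1 → ℝ),
            (∀ i j, 0 ≤ B i j) ∧ ∀ v : Fin g.1 → Bool, g.2 v = true ↔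
              ∃ Y : Matrix (Fin q) (Fin q) ℝ, Y.PosSemidef ∧
                ∀ i, (A i * Y).trace ≤ b i + ∑ j, B i j * (if v j then (1 : ℝ) else 0)}) →
        C.size ≤ 1 →
        ¬ C.Computes (fun x => decide (¬ (SimpleGraph.fromEdgeSet {e : Sym2 (Fin m) |
          ∃ h : e ∈ (⊤ : SimpleGraph (Fin m)).edgeSet, x ⟨e, h⟩ = true}).CliqueFree
            ⌈(m : ℝ) ^ δ⌉₊)) := by
  refine ⟨1 / 4, by norm_num, by norm_num, fun c => ?_⟩
  filter_upwards [eventually_threshold_corner_conditions 0, eventually_sdpFewDims_condition,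
    eventually_sdpFewDims_budget c] with m hm hH hbud C hC hsize
  obtain ⟨h3, h8, hk2, -, hm2⟩ := hm
  set k : ℕ := ⌈(m : ℝ) ^ (1 / 4 : ℝ)⌉₊ with hk
  have hs : 1 ≤ m ^ c := Nat.one_le_pow _ _ (by omega)
  have hkm : k ≤ m := le_trans (by nlinarith) hk2
  have hpos : 0 < 64 * (c + k + 2) := by omega
  -- the block budget `D = m / (64 (c + k + 2))`, `t = D - 1`
  set D : ℕ := m / (64 * (c + k + 2)) with hDdef
  have hD : 64 * (c + k + 2) * D ≤ m := Nat.mul_div_le m _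
  have hD1 : 1 ≤ D := (Nat.le_div_iff_mul_le hpos).2 (by simpa using hbud)
  have hN := fun (w : (⊤ : SimpleGraph (Fin m)).edgeSet → ℝ) (hw : ∀ e, 0 ≤ w e) (θ : ℝ)
    (hθ : 0 < θ) (hQ : ∀ Q : Finset (Fin m), Q.card = k →
      θ ≤ ∑ e, if cliqueVec Q e = true then w e else 0) =>
    card_colorings_sum_lt_le_half (by omega) hkm w hw hθ hQ
  have hDt : D - 1 + 1 = D := by omega
  have hnum : (m ^ c + 1) ^ (D - 1 + 1) * m ^ k * (D - 1 + 1 + m ^ k + 2) ^ (D - 1 + 1) *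
      (k ^ 2 * m ^ (k ^ 2) * (k - 1) ^ ((m + k) / 2 + k ^ 2)) < (k - 1) ^ m := by
    rw [hDt]
    exact sdpFewDims_numerics (c := c) h3 h8 hk2 hD1 hD hH hm2
  refine not_computes_cliqueFn_of_convFew (s := m ^ c) (t := D - 1) h3 hkm hs hN hnum C
    (fun g hg => ?_) hsize
  rcases hC g hg with h | ⟨p, q, hpq, hq', A, b, B, hB, hiff⟩
  · exact Or.inl h
  · refine Or.inr ⟨p, q, hpq, ?_, A, b, B, hB, hiff⟩
    have : q * q + 1 ≤ D := (Nat.le_div_iff_mul_le hpos).2 (by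
      calc (q * q + 1) * (64 * (c + k + 2)) = 64 * (c + k + 2) * (q * q + 1) := by ring
        _ ≤ m := hq')
    omega

end sdpFewDimsCorner

end Summit.PneNP.PneNP.Theorems
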